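import Summits.QuantumFields.BalabanUV.Beta.D1BFx.KCombineCov
import Summits.QuantumFields.BalabanUV.Beta.D1BFx.KGhostLegJunction
import Summits.QuantumFields.BalabanUV.Beta.D1BFx.KGhostTerm

/-!
# `BalabanUV.Beta.D1BFx.KCombineCovLegs` — road «BF-x» for binder row D1, slot (K), (K) CLOSURE PLAN (R1-L) v0.2 §7 rows **(A1′-N) «N-LEG LETTER»**
# and **(A1′-Φ) «GRAM-COV LEG»** of `KCombineCov` (p251661): the two LEG letters of the covariant organisation at the rooted gauge basis `Ŵ₀ = What0`
# and TB4-W's co-frame weight datum `T₀ := Tjet₀ N̂ e₁`, `A₀ := Ajet₀ N̂` (owner d1-p2-g9 list, journal 2026-08-21 l.28128)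

HONEST FRAMING (cell contract, verbatim): «discharging `BetaPertH` makes Bałaban's UV stability UNCONDITIONAL — a real constructive-QFT
result; it is NOT the continuum limit and NOT the Clay problem.»  HONEST DEPENDENCY (verbatim): «continuum YM on T⁴ ⇐ BetaPertH ∧ nine
spine estimates (0/9 proved); BetaPertH ⇐ (D1) ∧ (D4) ∧ CAP+tail; G-an2-4 gates asym, D1 and NE2/3/4.»  THIS MODULE DISCHARGES NOTHING of
D1 ∕ BetaPertH: [folklore] finite matrix algebra and compositions BY NAME of landed identities — the owner's `TorusZerothJunction`
(`inv_kkt_gram_eq_blocksHat`, `coframe_mul_basis_road`, `det_coframe_mul_basis_road_ne_zero`, `det_weightA_road_ne_zero`), this lineage's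
`TorusCoframeJets` (`Tjet₀_eq_coframe`, `Ajet₀_eq_weightA`), `TorusGaugeBasis(Kernel)` (`Khat_mul_What0`, `Nhat_range`, `Nhat_injective`,
`What0_eq_DhatS_mul_Nhat`, `junction_Nhat`), `TorusWeightJetsCombFree.Chat`, the owner's `KGhostLeg` (`Cgh`, `tendsto_hessT_Cgh`, `hessT_submatrix_unit`),
`KGhostLegJunction.Chat_Nhat_eq_submatrix_periodiseF_Cgh`, `KGhostTerm.hessT_compress`, gan24-leaf-03's `GramWeightJets(Mixed)` and
`SliceTransferDefectWard` (`gram•_eq_ward`, `gram•_add_weight`), `KCombineCov.hessKer_transfer_road_cov`.  No `def`, no `def … : Prop`, nothing cited, 0 sorry.  NOT summit progress; NOT BetaPertH, NOT continuum, NOT Clay.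

ABSOLUTE RULE (cell, verbatim): «No internally-minted statement may enter as a cited fact. Every hypothesis is either kernel-proved in this
package or a verbatim quotation of a PUBLISHED theorem with page reference. The manuscript(s) under audit are NOT citable for their own
disputed steps — they are the thing under adjudication; programme-internal (2001/route/tribunal) claims are never citable.»

ANSWERS TO THE OWNER'S TWO QUESTIONS (l.28128).  (A1′-N) YES: TB4-W's order-0 weight `gram₀ (Tjet₀ ((m+1)p) N (e₁ (m+1) p)) (Ajet₀ ((m+1)p) N)`
IS route T's `B₀ = T₀ᵀA₀T₀`, `T₀ = NᵀL̂D̂ₛᵀ`, `A₀ = 2•(NᵀL̂L̂N)⁻¹` (definitionally after `Tjet₀_eq_coframe`, §1), so the N-LEG letter `hLN` of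
`KCombineCov.identity_array_currency_cov(_What0)` at this datum IS TB5's `TorusZerothJunction.inv_kkt_gram_eq_blocksHat`, `NL := NlegRoad m a`, modulo
`Spr (Ga (m+1) a)` only (§1).  (A1′-Φ) `Φ₀ = Ŵ₀ᵀ(K̂ + B₀)Ŵ₀ = (T₀Ŵ₀)ᵀA₀(T₀Ŵ₀) = 2•(N̂ᵀL̂L̂N̂)` (`K̂Ŵ₀ = 0`, `T₀Ŵ₀ = N̂ᵀL̂L̂N̂`; §2), so `Φ₀⁻¹ = ½•(N̂ᵀL̂L̂N̂)⁻¹` and,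
compressed to the fine sites, `N̂Φ₀⁻¹N̂ᵀ = ½•Ĉ = ½•(m+1)⁴•Ĝ′(1 − P̂)Ĝ′ = ½•(Cgh (m+1) a)^`: **the `ℤ⁴` leg of the covariant Gram tower is the COMPOSITE GHOST
LEG `Cgh (m+1) a = (m+1)⁴·(Ggh ∘ (δ − Pgt) ∘ Ggh)` of TB5-2c — the SAME scalar fine-site leg as the ghost tower — and NOT the coarse gluon Gram `(m+1)⁸·(𝒬Ga𝒬ᵀ)⁻¹` (a vector coarse-block kernel);**
the socket `hGPhi` of `KCombineCov.hessKer_transfer_road_cov` at `GΦ := Cgh (m+1) a` IS `KGhostLeg.tendsto_hessT_Cgh` (§5), the factor `½` riding on the words (§4).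

CONTENT (all [folklore]; `s = (m+1)·p`, `N̂ = Nhat r (m+1) p`, `Ŵ₀ = What0 r (m+1) p = D̂ₛN̂`, `T₀ = Tjet₀ s N̂ (e₁ (m+1) p)`, `A₀ = Ajet₀ s N̂`, `B₀ = gram₀ T₀ A₀`).
* §1 (A1′-N): `gram₀_Tjet₀_Ajet₀_eq`, **`inv_kkt_gram₀_Tjet_eq_blocksHat`** (any basis `N` of `ker Ŝ`), **`inv_kkt_gram₀_Tjet_Nhat_eq_blocksHat`**.
* §2 `Φ₀` at the road datum: `Tjet₀_mul_What0`, **`gram₀_What0_road_eq`** (`Φ₀ = 2•N̂ᵀL̂L̂N̂`); the three non-degeneracy letters of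
  `KCombineCov.identity_array_currency_cov_What0` DISCHARGED here — `det_Tjet₀_mul_What0_ne_zero` (`hTW`), `det_Ajet₀_Nhat_ne_zero` (`hA`),
  **`det_gram₀_What0_road_ne_zero`** (`hΦ`); `inv_gram₀_What0_road_eq`; **`Nhat_mul_inv_gram₀_What0_mul_transpose(_eq_Cgh)`** (`N̂Φ₀⁻¹N̂ᵀ = ½•Ĉ = ½•(Cgh)^ι`).
* §3 generic algebra: column sandwiches `gram• (M•·N) Y• = Nᵀ·(gram• M• Y•)·N`; **`gram₁∕gramMix_eq_zero_of_wardL`** and **`gram₁∕gramMix_add_eq_of_wardL`**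
  (the `K`-part of the covariant Gram jets VANISHES under the four WARD-L letters of `KCombineCov` §2, over the owner's `SliceTransferDefectWard.gram•_eq_ward`
  ∕ `gram•_add_weight`): `gram• Ŵ (K + B) = gram• Ŵ B`; **`hessT_gram_compress`** (gauge jets `W• = M•·N` ⟹ site functional with the compressed leg `N·(gram₀ (M₀N) Y₀)⁻¹·Nᵀ`).
* §4 `hessT_submatrix_fst`; **`hessT_gramCov_What0_eq_Cgh`** — THE «GRAM-COV» FUNCTIONAL `bΦ` OF `KCombineCov` §3′ IN FIBRED SITE CURRENCY: for `W• = M•·N̂`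
  (letters) and ANY weight jets `Y•`, `hessT (Φ₀⁻¹; gram₁ Ŵ₀ W• Y₀ Y•, gramMix …) = hessT ((Cgh (m+1) a)^; (½•gram₁ D̂ₛ M• Y₀ Y•)ᶠ, (½•gramMix D̂ₛ M• Y•)ᶠ)`,
  `Xᶠ := X.submatrix Prod.fst Prod.fst` — what remains for the dictionary letter `hbΦ` is the ARRAY reading of three site words ((A2-Φ)).
* §5 **`tendsto_hessT_GPhi`** (reserved socket name; `GΦ := Cgh (m+1) a`; = `KGhostLeg.tendsto_hessT_Cgh`) and **`hessKer_transfer_road_cov_Cgh`**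
  (`KCombineCov.hessKer_transfer_road_cov` with the «GRAM-COV LEG» socket DISCHARGED; displayed: `hId`, «COMB-FP LEG» `hGtau`, BiLoc letters, `Spr (Ga (m+1) a)`).
WHAT IT IS NOT: not WARD-L (letters stay hypotheses), not the array reading of the site words (A2-Φ), not the comb-FP leg (A1′-τ), not the END.
Unit `b2b-balaban-beta-d1-formalise-leaf-03` (gen 11), claims «(A1′-N)» + «(A1′-Φ) GRAM-COV LEG» (journal l.28214); road owner `b2b-balaban-beta-d1-p2`.
-/

noncomputable section

namespace Summit.QuantumFields.BalabanUV.Beta.D1BFx.KCombineCovLegs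

open Matrix Filter Topology
open scoped BigOperators
open Literature.MathematicalPhysics.QuantumFieldTheory.Balaban1983to89
open Literature.MathematicalPhysics.QuantumFieldTheory.Balaban1983to89.Beta
open Literature.MathematicalPhysics.QuantumFieldTheory.Balaban1983to89.Beta.Composition (kkt)
open ExpKernelCalculus (MKer Decays BiLoc hessKer shiftK)
open AffineAveraging (box toSite)
open OneStepResolventKernel (Fib)
open OneStepKernelFamily (KInvStep)
open Summit.QuantumFields.BalabanUV.Beta.TameKernelCalculus (Spr)
open Summit.QuantumFields.BalabanUV.Beta.AxialDressingRooted (coDressKBmAt)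
open Summit.QuantumFields.BalabanUV.Beta.D1BFx.FibredPeriodisation (periodiseF)
open Summit.QuantumFields.BalabanUV.Beta.D1BFx.SortedKernels (blocksHat)
open Summit.QuantumFields.BalabanUV.Beta.D1BFx.SortedPack (sortK)
open Summit.QuantumFields.BalabanUV.Beta.D1BFx.SortedEmbedding (e₁)
open Summit.QuantumFields.BalabanUV.Beta.D1BFx.PeriodicArrays (arr toF)
open Summit.QuantumFields.BalabanUV.Beta.D1BFx.MixedVarPackedHess (hessT)
open Summit.QuantumFields.BalabanUV.Beta.D1BFx.GramWeightJets (gram₀ gram₁)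
open Summit.QuantumFields.BalabanUV.Beta.D1BFx.GramWeightJetsMixed (gramMix)
open Summit.QuantumFields.BalabanUV.Beta.D1BFx.TorusCombKKT (I J CombRows tauT Khat Qhat)
open Summit.QuantumFields.BalabanUV.Beta.D1BFx.TorusGaugeBasis (What0 Khat_mul_What0)
open Summit.QuantumFields.BalabanUV.Beta.D1BFx.TorusGaugeBasisMatrix (Nhat)
open Summit.QuantumFields.BalabanUV.Beta.D1BFx.TorusGaugeBasisKernel (Nhat_range Nhat_injective What0_eq_DhatS_mul_Nhat junction_Nhat)
open Summit.QuantumFields.BalabanUV.Beta.D1BFx.PeriodisedProjector (Lhat Shat)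
open Summit.QuantumFields.BalabanUV.Beta.D1BFx.TorusGaugeWeight (Lhat_transpose)
open Summit.QuantumFields.BalabanUV.Beta.D1BFx.TorusHodgeWeight (Dhat DhatS)
open Summit.QuantumFields.BalabanUV.Beta.D1BFx.TorusCoframeJets (Tjet₀ Ajet₀ Gjet₀ Tjet₀_eq_coframe Ajet₀_eq_weightA)
open Summit.QuantumFields.BalabanUV.Beta.D1BFx.TorusWeightJetsCombFree (Chat)
open Summit.QuantumFields.BalabanUV.Beta.D1BFx.TorusZerothJunction (inv_kkt_gram_eq_blocksHat coframe_mul_basis_road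
  det_coframe_mul_basis_road_ne_zero det_weightA_road_ne_zero)
open Summit.QuantumFields.BalabanUV.Beta.D1BFx.RWeightedLegPack (NlegRoad)
open Summit.QuantumFields.BalabanUV.Beta.D1BFx.KGhostLeg (Cgh tendsto_hessT_Cgh hessT_submatrix_unit)
open Summit.QuantumFields.BalabanUV.Beta.D1BFx.KGhostLegJunction (Chat_Nhat_eq_submatrix_periodiseF_Cgh)
open Summit.QuantumFields.BalabanUV.Beta.D1BFx.KGhostTerm (hessT_compress)
open Summit.QuantumFields.BalabanUV.Beta.D1BFx.SliceTransferDefectWard (gram₁_eq_ward gramMix_eq_ward gram₁_add_weight gramMix_add_weight)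
open Summit.QuantumFields.BalabanUV.Beta.D1BFx.KCombineCov (hessKer_transfer_road_cov)

/-! ## §1 (A1′-N) The N-LEG letter `hLN` at TB4-W's order-0 datum IS TB5's `NlegRoad` letter -/

section NLeg

variable (m : ℕ) {a : ℝ} (p : ℕ) [NeZero p] {ρ : Type*} [Fintype ρ] [DecidableEq ρ]

/-- [folklore] **TB4-W's ORDER-0 WEIGHT IS ROUTE T's `B₀`**: `gram₀ (Tjet₀ N e₁) (Ajet₀ N) = (NᵀL̂D̂ₛᵀ)ᵀ·(2•(NᵀL̂L̂N)⁻¹)·(NᵀL̂D̂ₛᵀ)` (`Tjet₀_eq_coframe`). -/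
theorem gram₀_Tjet₀_Ajet₀_eq (N : Matrix (Site 4 ((m + 1) * p)) ρ ℝ) :
    gram₀ (Tjet₀ ((m + 1) * p) N (e₁ (m + 1) p)) (Ajet₀ ((m + 1) * p) N)
      = (Nᵀ * Lhat ((m + 1) * p) * (DhatS m p)ᵀ)ᵀ * ((2 : ℝ) • (Nᵀ * Lhat ((m + 1) * p) * Lhat ((m + 1) * p) * N)⁻¹)
          * (Nᵀ * Lhat ((m + 1) * p) * (DhatS m p)ᵀ) := by
  rw [gram₀, Tjet₀_eq_coframe, Ajet₀_eq_weightA]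

/-- [folklore] **THE N-LEG LETTER `hLN` AT TB4-W's DATUM, ANY BASIS `N` OF `ker Ŝ`**: `(kkt (K̂ + gram₀ (Tjet₀ N e₁) (Ajet₀ N)) Q̂)⁻¹ =
blocksHat p (sortK (m+1) (NlegRoad m a))` (`TorusZerothJunction.inv_kkt_gram_eq_blocksHat` after §1's bridge; displayed: `0 < a`, `Spr (Ga (m+1) a)`, `hN`∕`hNinj`). -/
theorem inv_kkt_gram₀_Tjet_eq_blocksHat (ha : 0 < a) (hGa : Spr (GluonLeg.Ga (m + 1) a)) {N : Matrix (Site 4 ((m + 1) * p)) ρ ℝ}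
    (hN : ∀ lam : Site 4 ((m + 1) * p) → ℝ, Shat m ((m + 1) * p) *ᵥ lam = 0 ↔ ∃ c : ρ → ℝ, lam = N *ᵥ c)
    (hNinj : Function.Injective N.mulVec) :
    (kkt (Khat (d := 3) (m + 1) p + gram₀ (Tjet₀ ((m + 1) * p) N (e₁ (m + 1) p)) (Ajet₀ ((m + 1) * p) N)) (Qhat (d := 3) (m + 1) p))⁻¹
      = blocksHat p (sortK (m + 1) (NlegRoad m a)) := by
  rw [gram₀_Tjet₀_Ajet₀_eq]
  exact inv_kkt_gram_eq_blocksHat m p ha hGa hN hNinj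

/-- [folklore] **THE N-LEG LETTER `hLN` AT THE CANONICAL COMB BASIS `N̂`** (`r ∈ box 4 (m+1)`; basis facts from `TorusGaugeBasisKernel`): the `hLN`
hypothesis of `KCombineCov.identity_array_currency_cov_What0` at `T₀ := Tjet₀ N̂ e₁`, `A₀ := Ajet₀ N̂`, `NL := NlegRoad m a`, modulo `Spr (Ga (m+1) a)`. -/
theorem inv_kkt_gram₀_Tjet_Nhat_eq_blocksHat (ha : 0 < a) (hGa : Spr (GluonLeg.Ga (m + 1) a)) {r : Fin 4 → ℕ} (hr : r ∈ box 4 (m + 1)) :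
    (kkt (Khat (d := 3) (m + 1) p + gram₀ (Tjet₀ ((m + 1) * p) (Nhat r (m + 1) p) (e₁ (m + 1) p)) (Ajet₀ ((m + 1) * p) (Nhat r (m + 1) p)))
        (Qhat (d := 3) (m + 1) p))⁻¹ = blocksHat p (sortK (m + 1) (NlegRoad m a)) :=
  inv_kkt_gram₀_Tjet_eq_blocksHat m p ha hGa (Nhat_range r m p hr) (Nhat_injective r (m + 1) p hr)

end NLeg

/-! ## §2 (A1′-Φ) The order-0 covariant Gram `Φ₀` at the road datum: `Φ₀ = 2•N̂ᵀL̂L̂N̂`, `N̂Φ₀⁻¹N̂ᵀ = ½•Ĉ = (½•(Cgh)^)` re-indexed -/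

section GramZero

variable (m : ℕ) {a : ℝ} (p : ℕ) [NeZero p] {r : Fin 4 → ℕ}

/-- [folklore] **`T₀·Ŵ₀ = N̂ᵀL̂L̂N̂`** (`Tjet₀_eq_coframe`, `What0_eq_DhatS_mul_Nhat`, `coframe_mul_basis_road`). -/
theorem Tjet₀_mul_What0 (hr : r ∈ box 4 (m + 1)) :
    Tjet₀ ((m + 1) * p) (Nhat r (m + 1) p) (e₁ (m + 1) p) * What0 r (m + 1) p
      = (Nhat r (m + 1) p)ᵀ * Lhat ((m + 1) * p) * Lhat ((m + 1) * p) * Nhat r (m + 1) p := by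
  rw [Tjet₀_eq_coframe, What0_eq_DhatS_mul_Nhat r m p hr, coframe_mul_basis_road]

/-- [folklore] `det (N̂ᵀL̂L̂N̂) ≠ 0` in `IsUnit` form (`junction_Nhat`). -/
theorem isUnit_det_gramLap (ha : 0 < a) (hr : r ∈ box 4 (m + 1)) :
    IsUnit ((Nhat r (m + 1) p)ᵀ * Lhat ((m + 1) * p) * Lhat ((m + 1) * p) * Nhat r (m + 1) p).det :=
  (junction_Nhat r m p ha hr).1

/-- [folklore] **`hTW` DISCHARGED**: `det (T₀·Ŵ₀) ≠ 0` at the road datum. -/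
theorem det_Tjet₀_mul_What0_ne_zero (ha : 0 < a) (hr : r ∈ box 4 (m + 1)) :
    (Tjet₀ ((m + 1) * p) (Nhat r (m + 1) p) (e₁ (m + 1) p) * What0 r (m + 1) p).det ≠ 0 := by
  rw [Tjet₀_eq_coframe, What0_eq_DhatS_mul_Nhat r m p hr]
  exact det_coframe_mul_basis_road_ne_zero m p ha (Nhat_range r m p hr) (Nhat_injective r (m + 1) p hr)

/-- [folklore] **`hA` DISCHARGED**: `det A₀ ≠ 0` at the road datum (`det_weightA_road_ne_zero`). -/
theorem det_Ajet₀_Nhat_ne_zero (ha : 0 < a) (hr : r ∈ box 4 (m + 1)) :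
    (Ajet₀ ((m + 1) * p) (Nhat r (m + 1) p)).det ≠ 0 := by
  rw [Ajet₀_eq_weightA]
  exact det_weightA_road_ne_zero m p ha (Nhat_range r m p hr) (Nhat_injective r (m + 1) p hr)

/-- [folklore] **THE ORDER-0 COVARIANT GRAM AT THE ROAD DATUM: `Φ₀ = Ŵ₀ᵀ(K̂ + B₀)Ŵ₀ = 2•N̂ᵀL̂L̂N̂`** — the `K̂`-part dies by the order-0 WARD-L letter
`K̂Ŵ₀ = 0` (`Khat_mul_What0`), and `Ŵ₀ᵀB₀Ŵ₀ = (T₀Ŵ₀)ᵀA₀(T₀Ŵ₀) = G·(2•G⁻¹)·G = 2•G`, `G := N̂ᵀL̂L̂N̂`. -/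
theorem gram₀_What0_road_eq (ha : 0 < a) (hr : r ∈ box 4 (m + 1)) :
    gram₀ (What0 r (m + 1) p) (Khat (d := 3) (m + 1) p
        + gram₀ (Tjet₀ ((m + 1) * p) (Nhat r (m + 1) p) (e₁ (m + 1) p)) (Ajet₀ ((m + 1) * p) (Nhat r (m + 1) p)))
      = (2 : ℝ) • ((Nhat r (m + 1) p)ᵀ * Lhat ((m + 1) * p) * Lhat ((m + 1) * p) * Nhat r (m + 1) p) := by
  have hK : Khat (d := 3) (m + 1) p * What0 r (m + 1) p = 0 := Khat_mul_What0 r (m + 1) p hr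
  have hTW := Tjet₀_mul_What0 m p hr
  have e : gram₀ (What0 r (m + 1) p) (Khat (d := 3) (m + 1) p
        + gram₀ (Tjet₀ ((m + 1) * p) (Nhat r (m + 1) p) (e₁ (m + 1) p)) (Ajet₀ ((m + 1) * p) (Nhat r (m + 1) p)))
      = (What0 r (m + 1) p)ᵀ * (Khat (d := 3) (m + 1) p * What0 r (m + 1) p)
        + (Tjet₀ ((m + 1) * p) (Nhat r (m + 1) p) (e₁ (m + 1) p) * What0 r (m + 1) p)ᵀ * Ajet₀ ((m + 1) * p) (Nhat r (m + 1) p)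
          * (Tjet₀ ((m + 1) * p) (Nhat r (m + 1) p) (e₁ (m + 1) p) * What0 r (m + 1) p) := by
    simp only [gram₀, Matrix.mul_add, Matrix.add_mul, Matrix.transpose_mul, Matrix.mul_assoc]
  have hGt : ((Nhat r (m + 1) p)ᵀ * Lhat ((m + 1) * p) * Lhat ((m + 1) * p) * Nhat r (m + 1) p)ᵀ
      = (Nhat r (m + 1) p)ᵀ * Lhat ((m + 1) * p) * Lhat ((m + 1) * p) * Nhat r (m + 1) p := by
    rw [Matrix.transpose_mul, Matrix.transpose_mul, Matrix.transpose_mul, Matrix.transpose_transpose, Lhat_transpose]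
    simp only [Matrix.mul_assoc]
  rw [e, hK, Matrix.mul_zero, zero_add, hTW, hGt, Ajet₀_eq_weightA, Matrix.mul_smul, Matrix.smul_mul,
    Matrix.mul_nonsing_inv _ (isUnit_det_gramLap m p ha hr), Matrix.one_mul]

/-- [folklore] **`hΦ` DISCHARGED**: `det Φ₀ ≠ 0` at the road datum. -/
theorem det_gram₀_What0_road_ne_zero (ha : 0 < a) (hr : r ∈ box 4 (m + 1)) :
    (gram₀ (What0 r (m + 1) p) (Khat (d := 3) (m + 1) p
        + gram₀ (Tjet₀ ((m + 1) * p) (Nhat r (m + 1) p) (e₁ (m + 1) p)) (Ajet₀ ((m + 1) * p) (Nhat r (m + 1) p)))).det ≠ 0 := by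
  rw [gram₀_What0_road_eq m p ha hr, Matrix.det_smul, Fintype.card]
  exact mul_ne_zero (pow_ne_zero _ two_ne_zero) (isUnit_det_gramLap m p ha hr).ne_zero

/-- [folklore] **`Φ₀⁻¹ = ½•(N̂ᵀL̂L̂N̂)⁻¹`** at the road datum. -/
theorem inv_gram₀_What0_road_eq (ha : 0 < a) (hr : r ∈ box 4 (m + 1)) :
    (gram₀ (What0 r (m + 1) p) (Khat (d := 3) (m + 1) p
        + gram₀ (Tjet₀ ((m + 1) * p) (Nhat r (m + 1) p) (e₁ (m + 1) p)) (Ajet₀ ((m + 1) * p) (Nhat r (m + 1) p))))⁻¹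
      = (1 / 2 : ℝ) • ((Nhat r (m + 1) p)ᵀ * Lhat ((m + 1) * p) * Lhat ((m + 1) * p) * Nhat r (m + 1) p)⁻¹ := by
  rw [gram₀_What0_road_eq m p ha hr]
  refine Matrix.inv_eq_left_inv ?_
  rw [Matrix.smul_mul, Matrix.mul_smul, smul_smul, Matrix.nonsing_inv_mul _ (isUnit_det_gramLap m p ha hr)]
  norm_num

/-- [folklore] **THE COMPRESSED LEG: `N̂·Φ₀⁻¹·N̂ᵀ = ½•Ĉ`** (`Ĉ = TorusWeightJetsCombFree.Chat s N̂ = N̂(N̂ᵀL̂L̂N̂)⁻¹N̂ᵀ`). -/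
theorem Nhat_mul_inv_gram₀_What0_mul_transpose (ha : 0 < a) (hr : r ∈ box 4 (m + 1)) :
    Nhat r (m + 1) p * (gram₀ (What0 r (m + 1) p) (Khat (d := 3) (m + 1) p
        + gram₀ (Tjet₀ ((m + 1) * p) (Nhat r (m + 1) p) (e₁ (m + 1) p)) (Ajet₀ ((m + 1) * p) (Nhat r (m + 1) p))))⁻¹ * (Nhat r (m + 1) p)ᵀ
      = (1 / 2 : ℝ) • Chat ((m + 1) * p) (Nhat r (m + 1) p) := by
  rw [inv_gram₀_What0_road_eq m p ha hr, Chat, Gjet₀, Matrix.mul_smul, Matrix.smul_mul]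

/-- [folklore] **THE COMPRESSED LEG IS `½•(Cgh (m+1) a)^` RE-INDEXED** (`KGhostLegJunction.Chat_Nhat_eq_submatrix_periodiseF_Cgh`): the `ℤ⁴` leg of the
covariant Gram tower is the composite ghost leg `Cgh (m+1) a = (m+1)⁴·(Ggh ∘ (δ − Pgt) ∘ Ggh)` of TB5-2c, halved. -/
theorem Nhat_mul_inv_gram₀_What0_mul_transpose_eq_Cgh (ha : 0 < a) (hr : r ∈ box 4 (m + 1)) :
    Nhat r (m + 1) p * (gram₀ (What0 r (m + 1) p) (Khat (d := 3) (m + 1) p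
        + gram₀ (Tjet₀ ((m + 1) * p) (Nhat r (m + 1) p) (e₁ (m + 1) p)) (Ajet₀ ((m + 1) * p) (Nhat r (m + 1) p))))⁻¹ * (Nhat r (m + 1) p)ᵀ
      = (1 / 2 : ℝ) • (Matrix.of (periodiseF ((m + 1) * p) (toF (Cgh (m + 1) a)))).submatrix (fun x => (x, ())) (fun y => (y, ())) := by
  rw [Nhat_mul_inv_gram₀_What0_mul_transpose m p ha hr, Chat_Nhat_eq_submatrix_periodiseF_Cgh m p ha hr]

end GramZero

/-! ## §3 Generic algebra: column sandwiches, linearity in the weight, WARD-L kills the `K`-part, compression of the Gram functional -/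

section Algebra

variable {ι κ σ : Type*} [Fintype ι] [Fintype κ] [Fintype σ]

omit [Fintype κ] in
/-- [folklore] Column sandwich, order 0: `gram₀ (M₀N) Y₀ = Nᵀ·(gram₀ M₀ Y₀)·N`. -/
theorem gram₀_mul_basis (M₀ : Matrix ι σ ℝ) (N : Matrix σ κ ℝ) (Y₀ : Matrix ι ι ℝ) :
    gram₀ (M₀ * N) Y₀ = Nᵀ * gram₀ M₀ Y₀ * N := by
  simp only [gram₀, Matrix.transpose_mul, Matrix.mul_assoc]

omit [Fintype κ] in
/-- [folklore] Column sandwich, order 1: `gram₁ (M₀N) (MₛN) Y₀ Yₛ = Nᵀ·(gram₁ M₀ Mₛ Y₀ Yₛ)·N`. -/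
theorem gram₁_mul_basis (M₀ Mₛ : Matrix ι σ ℝ) (N : Matrix σ κ ℝ) (Y₀ Yₛ : Matrix ι ι ℝ) :
    gram₁ (M₀ * N) (Mₛ * N) Y₀ Yₛ = Nᵀ * gram₁ M₀ Mₛ Y₀ Yₛ * N := by
  simp only [gram₁, Matrix.transpose_mul, Matrix.add_mul, Matrix.mul_add, Matrix.mul_assoc]

omit [Fintype κ] in
/-- [folklore] Column sandwich, mixed order 2: `gramMix (M₀N) (MₛN) (MₜN) (MₛₜN) Y• = Nᵀ·(gramMix M₀ Mₛ Mₜ Mₛₜ Y•)·N`. -/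
theorem gramMix_mul_basis (M₀ Mₛ Mₜ Mₛₜ : Matrix ι σ ℝ) (N : Matrix σ κ ℝ) (Y₀ Yₛ Yₜ Yₛₜ : Matrix ι ι ℝ) :
    gramMix (M₀ * N) (Mₛ * N) (Mₜ * N) (Mₛₜ * N) Y₀ Yₛ Yₜ Yₛₜ = Nᵀ * gramMix M₀ Mₛ Mₜ Mₛₜ Y₀ Yₛ Yₜ Yₛₜ * N := by
  simp only [gramMix, Matrix.transpose_mul, Matrix.add_mul, Matrix.mul_add, Matrix.mul_assoc]

variable (W₀ Wₛ Wₜ Wₛₜ : Matrix ι κ ℝ) (K₀ Kₛ Kₜ Kₛₜ B₀ Bₛ Bₜ Bₛₜ : Matrix ι ι ℝ)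

omit [Fintype κ] in
/-- [folklore] **WARD-L KILLS THE `K`-PART, ORDER 1**: `K₀W₀ = 0`, `KₛW₀ + K₀Wₛ = 0 ⟹ gram₁ W₀ Wₛ K₀ Kₛ = 0` (the owner's
`SliceTransferDefectWard.gram₁_eq_ward`: `gram₁ = Wₛᵀ(K₀W₀) + W₀ᵀ(KₛW₀ + K₀Wₛ)`; no symmetry needed). -/
theorem gram₁_eq_zero_of_wardL (hE₀ : K₀ * W₀ = 0) (hEₛ : Kₛ * W₀ + K₀ * Wₛ = 0) : gram₁ W₀ Wₛ K₀ Kₛ = 0 := by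
  rw [gram₁_eq_ward, hE₀, hEₛ, Matrix.mul_zero, Matrix.mul_zero, add_zero]

omit [Fintype κ] in
/-- [folklore] **WARD-L KILLS THE `K`-PART, MIXED ORDER 2**: the four WARD-L letters of `KCombineCov.hessT_transfer_wardL` give
`gramMix W₀ Wₛ Wₜ Wₛₜ K₀ Kₛ Kₜ Kₛₜ = 0` (`SliceTransferDefectWard.gramMix_eq_ward`). -/
theorem gramMix_eq_zero_of_wardL (hE₀ : K₀ * W₀ = 0) (hEₛ : Kₛ * W₀ + K₀ * Wₛ = 0) (hEₜ : Kₜ * W₀ + K₀ * Wₜ = 0)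
    (hEₛₜ : Kₛₜ * W₀ + Kₛ * Wₜ + Kₜ * Wₛ + K₀ * Wₛₜ = 0) : gramMix W₀ Wₛ Wₜ Wₛₜ K₀ Kₛ Kₜ Kₛₜ = 0 := by
  rw [gramMix_eq_ward, hE₀, hEₛ, hEₜ, hEₛₜ]
  simp only [Matrix.mul_zero, add_zero]

omit [Fintype κ] in
/-- [folklore] **THE COVARIANT GRAM JETS ARE `K`-FREE UNDER WARD-L, ORDER 1**: `gram₁ W₀ Wₛ (K₀ + B₀) (Kₛ + Bₛ) = gram₁ W₀ Wₛ B₀ Bₛ`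
(`SliceTransferDefectWard.gram₁_add_weight` + `gram₁_eq_zero_of_wardL`). -/
theorem gram₁_add_eq_of_wardL (hE₀ : K₀ * W₀ = 0) (hEₛ : Kₛ * W₀ + K₀ * Wₛ = 0) :
    gram₁ W₀ Wₛ (K₀ + B₀) (Kₛ + Bₛ) = gram₁ W₀ Wₛ B₀ Bₛ := by
  rw [gram₁_add_weight, gram₁_eq_zero_of_wardL W₀ Wₛ K₀ Kₛ hE₀ hEₛ, zero_add]

omit [Fintype κ] in
/-- [folklore] **… MIXED ORDER 2**: `gramMix W• (K• + B•) = gramMix W• B•` under the four WARD-L letters — so the «GRAM-COV» words of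
`KCombineCov.identity_array_currency_cov(_What0)` see ONLY the weight jets `B• = gram•(T•, A•)` (order 0: `gram₀_What0_road_eq`). -/
theorem gramMix_add_eq_of_wardL (hE₀ : K₀ * W₀ = 0) (hEₛ : Kₛ * W₀ + K₀ * Wₛ = 0) (hEₜ : Kₜ * W₀ + K₀ * Wₜ = 0)
    (hEₛₜ : Kₛₜ * W₀ + Kₛ * Wₜ + Kₜ * Wₛ + K₀ * Wₛₜ = 0) :
    gramMix W₀ Wₛ Wₜ Wₛₜ (K₀ + B₀) (Kₛ + Bₛ) (Kₜ + Bₜ) (Kₛₜ + Bₛₜ) = gramMix W₀ Wₛ Wₜ Wₛₜ B₀ Bₛ Bₜ Bₛₜ := by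
  rw [gramMix_add_weight, gramMix_eq_zero_of_wardL W₀ Wₛ Wₜ Wₛₜ K₀ Kₛ Kₜ Kₛₜ hE₀ hEₛ hEₜ hEₛₜ, zero_add]

variable [DecidableEq κ] [DecidableEq σ]

omit [DecidableEq σ] in
/-- [folklore] **COMPRESSION OF THE GRAM FUNCTIONAL TO THE SITES**: for column-sandwiched gauge jets `W• = M•·N` (`N : σ × κ`) and any weight jets
`Y•`, `hessT ((gram₀ (M₀N) Y₀)⁻¹; gram₁ (M₀N) (MₛN) Y₀ Yₛ, gram₁ (M₀N) (MₜN) Y₀ Yₜ, gramMix (M•N) Y•)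
= hessT (N·(gram₀ (M₀N) Y₀)⁻¹·Nᵀ; gram₁ M₀ Mₛ Y₀ Yₛ, gram₁ M₀ Mₜ Y₀ Yₜ, gramMix M₀ Mₛ Mₜ Mₛₜ Y•)` (`KGhostTerm.hessT_compress` ∘ the column sandwiches). -/
theorem hessT_gram_compress (M₀ Mₛ Mₜ Mₛₜ : Matrix ι σ ℝ) (N : Matrix σ κ ℝ) (Y₀ Yₛ Yₜ Yₛₜ : Matrix ι ι ℝ) :
    hessT (gram₀ (M₀ * N) Y₀)⁻¹ (gram₁ (M₀ * N) (Mₛ * N) Y₀ Yₛ) (gram₁ (M₀ * N) (Mₜ * N) Y₀ Yₜ)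
        (gramMix (M₀ * N) (Mₛ * N) (Mₜ * N) (Mₛₜ * N) Y₀ Yₛ Yₜ Yₛₜ)
      = hessT (N * (gram₀ (M₀ * N) Y₀)⁻¹ * Nᵀ) (gram₁ M₀ Mₛ Y₀ Yₛ) (gram₁ M₀ Mₜ Y₀ Yₜ) (gramMix M₀ Mₛ Mₜ Mₛₜ Y₀ Yₛ Yₜ Yₛₜ) := by
  rw [gram₁_mul_basis, gram₁_mul_basis, gramMix_mul_basis, hessT_compress]

end Algebra

/-! ## §4 (A1′-Φ) The «GRAM-COV» functional of `KCombineCov` §3′ in fibred site currency: leg `(Cgh (m+1) a)^`, halved site words -/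

section GramCov

/-- [folklore] **THE `Site ≃ Site × Unit` READING, SITE WORDS**: for a fibred leg `L` and SITE-indexed words `X X′ Y`,
`hessT (L.submatrix ι ι) X X′ Y = hessT L Xᶠ X′ᶠ Yᶠ`, `Xᶠ := X.submatrix Prod.fst Prod.fst` (`KGhostLeg.hessT_submatrix_unit`, `(Xᶠ).submatrix ι ι = X` by `rfl`). -/
theorem hessT_submatrix_fst {s : ℕ} [NeZero s] (L : Matrix (Site 4 s × Unit) (Site 4 s × Unit) ℝ) (X X' Y : Matrix (Site 4 s) (Site 4 s) ℝ) :
    hessT (L.submatrix (fun x => (x, ())) (fun y => (y, ()))) X X' Y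
      = hessT L (X.submatrix Prod.fst Prod.fst) (X'.submatrix Prod.fst Prod.fst) (Y.submatrix Prod.fst Prod.fst) :=
  hessT_submatrix_unit L (X.submatrix Prod.fst Prod.fst) (X'.submatrix Prod.fst Prod.fst) (Y.submatrix Prod.fst Prod.fst)

variable (m : ℕ) {a : ℝ} (p : ℕ) [NeZero p] {r : Fin 4 → ℕ}

/-- [folklore] **THE COVARIANT GRAM TOWER IS A ONE-LOOP FUNCTIONAL OF THE COMPOSITE GHOST LEG.**  At the rooted gauge basis `Ŵ₀ = What0 = D̂ₛN̂` with
TB4-W's datum (`Y₀ := K̂ + gram₀ (Tjet₀ N̂ e₁) (Ajet₀ N̂)`, letter `hY₀`), for gauge jets that are column sandwiches of the basis, `Wₛ = Mₛ·N̂`,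
`Wₜ = Mₜ·N̂`, `Wₛₜ = Mₛₜ·N̂` (letters; `M• : I 3 (m+1) p × Site`), and ARBITRARY weight jets `Yₛ Yₜ Yₛₜ`:
`hessT (Φ₀⁻¹; gram₁ Ŵ₀ Wₛ Y₀ Yₛ, gram₁ Ŵ₀ Wₜ Y₀ Yₜ, gramMix Ŵ₀ Wₛ Wₜ Wₛₜ Y₀ Yₛ Yₜ Yₛₜ)`
`= hessT ((Cgh (m+1) a)^; (½•gram₁ D̂ₛ Mₛ Y₀ Yₛ)ᶠ, (½•gram₁ D̂ₛ Mₜ Y₀ Yₜ)ᶠ, (½•gramMix D̂ₛ Mₛ Mₜ Mₛₜ Y₀ Yₛ Yₜ Yₛₜ)ᶠ)`, `Xᶠ := X.submatrix Prod.fst Prod.fst`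
(`0 < a`, `r ∈ box 4 (m+1)`).  The LHS is the `hbΦ` functional of `KCombineCov.identity_array_currency_cov_What0`; the RHS has the shape of
`KGhostLeg.tendsto_hessT_Cgh` once the three site words are read as periodised `ℤ⁴` arrays ((A2-Φ), not here). -/
theorem hessT_gramCov_What0_eq_Cgh (ha : 0 < a) (hr : r ∈ box 4 (m + 1))
    {Y₀ : Matrix (I 3 (m + 1) p) (I 3 (m + 1) p) ℝ}
    (hY₀ : Y₀ = Khat (d := 3) (m + 1) p
      + gram₀ (Tjet₀ ((m + 1) * p) (Nhat r (m + 1) p) (e₁ (m + 1) p)) (Ajet₀ ((m + 1) * p) (Nhat r (m + 1) p)))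
    (Yₛ Yₜ Yₛₜ : Matrix (I 3 (m + 1) p) (I 3 (m + 1) p) ℝ)
    (Mₛ Mₜ Mₛₜ : Matrix (I 3 (m + 1) p) (Site 4 ((m + 1) * p)) ℝ)
    {Wₛ Wₜ Wₛₜ : Matrix (I 3 (m + 1) p) (CombRows (toSite r) (m + 1) p) ℝ}
    (hWₛ : Wₛ = Mₛ * Nhat r (m + 1) p) (hWₜ : Wₜ = Mₜ * Nhat r (m + 1) p) (hWₛₜ : Wₛₜ = Mₛₜ * Nhat r (m + 1) p) :
    hessT (gram₀ (What0 r (m + 1) p) Y₀)⁻¹ (gram₁ (What0 r (m + 1) p) Wₛ Y₀ Yₛ) (gram₁ (What0 r (m + 1) p) Wₜ Y₀ Yₜ)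
        (gramMix (What0 r (m + 1) p) Wₛ Wₜ Wₛₜ Y₀ Yₛ Yₜ Yₛₜ)
      = hessT (Matrix.of (periodiseF ((m + 1) * p) (toF (Cgh (m + 1) a))))
          (((1 / 2 : ℝ) • gram₁ (DhatS m p) Mₛ Y₀ Yₛ).submatrix Prod.fst Prod.fst)
          (((1 / 2 : ℝ) • gram₁ (DhatS m p) Mₜ Y₀ Yₜ).submatrix Prod.fst Prod.fst)
          (((1 / 2 : ℝ) • gramMix (DhatS m p) Mₛ Mₜ Mₛₜ Y₀ Yₛ Yₜ Yₛₜ).submatrix Prod.fst Prod.fst) := by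
  -- the compressed leg (§2), read while `Φ₀` is still spelled with `What0`
  have hleg : Nhat r (m + 1) p * (gram₀ (What0 r (m + 1) p) Y₀)⁻¹ * (Nhat r (m + 1) p)ᵀ
      = (1 / 2 : ℝ) • (Matrix.of (periodiseF ((m + 1) * p) (toF (Cgh (m + 1) a)))).submatrix (fun x => (x, ())) (fun y => (y, ())) := by
    rw [hY₀]; exact Nhat_mul_inv_gram₀_What0_mul_transpose_eq_Cgh m p ha hr
  have hW : What0 r (m + 1) p = DhatS m p * Nhat r (m + 1) p := What0_eq_DhatS_mul_Nhat r m p hr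
  -- compress to the sites (§3), the basis `Ŵ₀ = D̂ₛN̂` rewritten back to `What0` inside the leg
  have hc := hessT_gram_compress (DhatS m p) Mₛ Mₜ Mₛₜ (Nhat r (m + 1) p) Y₀ Yₛ Yₜ Yₛₜ
  rw [← hW] at hc
  -- move the `½` from the leg to the words, then pass to fibred `Site × Unit` currency
  have hsmul : ∀ (L V V' X : Matrix (Site 4 ((m + 1) * p)) (Site 4 ((m + 1) * p)) ℝ),
      hessT ((1 / 2 : ℝ) • L) V V' X = hessT L ((1 / 2 : ℝ) • V) ((1 / 2 : ℝ) • V') ((1 / 2 : ℝ) • X) := by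
    intro L V V' X
    unfold hessT
    simp only [Matrix.smul_mul, Matrix.mul_smul, Matrix.trace_smul, smul_eq_mul]
  rw [hWₛ, hWₜ, hWₛₜ, hc, hleg, hsmul, hessT_submatrix_fst]

end GramCov

/-! ## §5 The socket under its reserved name and the `ℤ⁴` identity of `KCombineCov` §4 with the «GRAM-COV LEG» socket discharged -/

section Socket

variable (m : ℕ) {a : ℝ} {r : Fin 4 → ℕ}

/-- [folklore] **«GRAM-COV LEG» `tendsto_hessT_GPhi`** (the socket name reserved in `KCombineCov` §4) AT `GΦ := Cgh (m+1) a`: along the fine tori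
`Site 4 ((m+1)·p k)`, `p k → ∞`, for bi-localised scalar word families `𝒳Φ`, `𝒳Φ₂`, `hessT ((Cgh)^; (arr 𝒳Φ•)^) → hessKer (Cgh (m+1) a) 𝒳Φ 𝒳Φ₂ μ ν z`
— this IS the owner's `KGhostLeg.tendsto_hessT_Cgh` (TB5-2c-B) at block side `m+1`: the covariant Gram tower and the ghost tower share their `ℤ⁴` leg. -/
theorem tendsto_hessT_GPhi (ha : 0 < a) (𝒳Φ : Fin 4 → (Fin 4 → ℤ) → MKer 4 Unit)
    (𝒳Φ₂ : Fin 4 → (Fin 4 → ℤ) → Fin 4 → (Fin 4 → ℤ) → MKer 4 Unit) (μ ν : Fin 4) (z : Fin 4 → ℤ)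
    {P P' Q Q' : Fin 4 → ℤ} {C Cv Cv' δ : ℝ}
    (hV : BiLoc (𝒳Φ μ 0) P P' Cv δ) (hV' : BiLoc (𝒳Φ ν z) Q' Q Cv' δ) (hW : BiLoc (𝒳Φ₂ μ 0 ν z) P Q C δ) (hδ : 0 < δ)
    {p : ℕ → ℕ} [∀ k, NeZero (p k)] (hp : Tendsto p atTop atTop) :
    Tendsto (fun k => hessT (Matrix.of (periodiseF ((m + 1) * p k) (toF (Cgh (m + 1) a))))
        (Matrix.of (periodiseF ((m + 1) * p k) (toF (arr ((m + 1) * p k) (𝒳Φ μ 0)))))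
        (Matrix.of (periodiseF ((m + 1) * p k) (toF (arr ((m + 1) * p k) (𝒳Φ ν z)))))
        (Matrix.of (periodiseF ((m + 1) * p k) (toF (arr ((m + 1) * p k) (𝒳Φ₂ μ 0 ν z)))))) atTop
      (𝓝 (hessKer (Cgh (m + 1) a) 𝒳Φ 𝒳Φ₂ μ ν z)) :=
  tendsto_hessT_Cgh (m + 1) a ha 𝒳Φ 𝒳Φ₂ μ ν z hV hV' hW hδ hp

/-- [folklore] **«K-TA4G-COMBINE» WITH THE «GRAM-COV LEG» SOCKET DISCHARGED**: `KCombineCov.hessKer_transfer_road_cov` at `GΦ := Cgh (m+1) a`, its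
hypothesis `hGPhi` supplied by `tendsto_hessT_GPhi`.  Displayed (unchanged): `Spr (Ga (m+1) a)`, `r ∈ box 4 (m+1)`, the BiLoc letters of the five word
families, the «COMB-FP LEG» socket `hGtau`, and the per-torus identity `hId` in array currency (whose Φ-slot is now `hessT ((Cgh (m+1) a)^; (arr 𝒳Φ•)^)`). -/
theorem hessKer_transfer_road_cov_Cgh (ha : 0 < a) (hGa : Spr (GluonLeg.Ga (m + 1) a)) (hr : r ∈ box (3 + 1) (m + 1))
    (𝒱M : Fin 4 → (Fin 4 → ℤ) → MKer 4 (Fib 3)) (𝒲M : Fin 4 → (Fin 4 → ℤ) → Fin 4 → (Fin 4 → ℤ) → MKer 4 (Fib 3))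
    (𝒱N : Fin 4 → (Fin 4 → ℤ) → MKer 4 (Fib 3)) (𝒲N : Fin 4 → (Fin 4 → ℤ) → Fin 4 → (Fin 4 → ℤ) → MKer 4 (Fib 3))
    (𝒳Φ : Fin 4 → (Fin 4 → ℤ) → MKer 4 Unit) (𝒳Φ₂ : Fin 4 → (Fin 4 → ℤ) → Fin 4 → (Fin 4 → ℤ) → MKer 4 Unit)
    (Gτ : MKer 4 Unit) (𝒳τ : Fin 4 → (Fin 4 → ℤ) → MKer 4 Unit) (𝒳τ₂ : Fin 4 → (Fin 4 → ℤ) → Fin 4 → (Fin 4 → ℤ) → MKer 4 Unit)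
    (μ ν : Fin 4) (z : Fin 4 → ℤ)
    {PM PM' QM QM' PN PN' QN QN' PΦ PΦ' QΦ QΦ' : Fin 4 → ℤ} {CvM CvM' CM δM CvN CvN' CN δN CvΦ CvΦ' CΦ δΦ : ℝ}
    (hVM : BiLoc (𝒱M μ 0) PM PM' CvM δM) (hVM' : BiLoc (𝒱M ν z) QM' QM CvM' δM) (hWM : BiLoc (𝒲M μ 0 ν z) PM QM CM δM) (hδM : 0 < δM)
    (hVN : BiLoc (𝒱N μ 0) PN PN' CvN δN) (hVN' : BiLoc (𝒱N ν z) QN' QN CvN' δN) (hWN : BiLoc (𝒲N μ 0 ν z) PN QN CN δN) (hδN : 0 < δN)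
    (hVΦ : BiLoc (𝒳Φ μ 0) PΦ PΦ' CvΦ δΦ) (hVΦ' : BiLoc (𝒳Φ ν z) QΦ' QΦ CvΦ' δΦ) (hWΦ : BiLoc (𝒳Φ₂ μ 0 ν z) PΦ QΦ CΦ δΦ) (hδΦ : 0 < δΦ)
    {p : ℕ → ℕ} [∀ k, NeZero (p k)] (hp : Tendsto p atTop atTop)
    (hGtau : Tendsto (fun k => hessT (Matrix.of (periodiseF ((m + 1) * p k) (toF Gτ)))
        (Matrix.of (periodiseF ((m + 1) * p k) (toF (arr ((m + 1) * p k) (𝒳τ μ 0)))))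
        (Matrix.of (periodiseF ((m + 1) * p k) (toF (arr ((m + 1) * p k) (𝒳τ ν z)))))
        (Matrix.of (periodiseF ((m + 1) * p k) (toF (arr ((m + 1) * p k) (𝒳τ₂ μ 0 ν z)))))) atTop (𝓝 (hessKer Gτ 𝒳τ 𝒳τ₂ μ ν z)))
    (hId : ∀ k,
      hessT (blocksHat (p k) (sortK (m + 1) (coDressKBmAt (toSite r) (m + 1) (KInvStep (d := 3) (m + 1) 0))))
          (blocksHat (p k) (sortK (m + 1) (arr ((m + 1) * p k) (𝒱M μ 0))))
          (blocksHat (p k) (sortK (m + 1) (arr ((m + 1) * p k) (𝒱M ν z))))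
          (blocksHat (p k) (sortK (m + 1) (arr ((m + 1) * p k) (𝒲M μ 0 ν z))))
        + hessT (Matrix.of (periodiseF ((m + 1) * p k) (toF (Cgh (m + 1) a))))
          (Matrix.of (periodiseF ((m + 1) * p k) (toF (arr ((m + 1) * p k) (𝒳Φ μ 0)))))
          (Matrix.of (periodiseF ((m + 1) * p k) (toF (arr ((m + 1) * p k) (𝒳Φ ν z)))))
          (Matrix.of (periodiseF ((m + 1) * p k) (toF (arr ((m + 1) * p k) (𝒳Φ₂ μ 0 ν z)))))
      = hessT (blocksHat (p k) (sortK (m + 1) (NlegRoad m a)))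
          (blocksHat (p k) (sortK (m + 1) (arr ((m + 1) * p k) (𝒱N μ 0))))
          (blocksHat (p k) (sortK (m + 1) (arr ((m + 1) * p k) (𝒱N ν z))))
          (blocksHat (p k) (sortK (m + 1) (arr ((m + 1) * p k) (𝒲N μ 0 ν z))))
        + 2 * hessT (Matrix.of (periodiseF ((m + 1) * p k) (toF Gτ)))
          (Matrix.of (periodiseF ((m + 1) * p k) (toF (arr ((m + 1) * p k) (𝒳τ μ 0)))))
          (Matrix.of (periodiseF ((m + 1) * p k) (toF (arr ((m + 1) * p k) (𝒳τ ν z)))))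
          (Matrix.of (periodiseF ((m + 1) * p k) (toF (arr ((m + 1) * p k) (𝒳τ₂ μ 0 ν z)))))) :
    hessKer (coDressKBmAt (toSite r) (m + 1) (KInvStep (d := 3) (m + 1) 0)) 𝒱M 𝒲M μ ν z + hessKer (Cgh (m + 1) a) 𝒳Φ 𝒳Φ₂ μ ν z
      = hessKer (NlegRoad m a) 𝒱N 𝒲N μ ν z + 2 * hessKer Gτ 𝒳τ 𝒳τ₂ μ ν z :=
  hessKer_transfer_road_cov m hGa hr 𝒱M 𝒲M 𝒱N 𝒲N (Cgh (m + 1) a) 𝒳Φ 𝒳Φ₂ Gτ 𝒳τ 𝒳τ₂ μ ν z hVM hVM' hWM hδM hVN hVN' hWN hδN hp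
    (tendsto_hessT_GPhi m ha 𝒳Φ 𝒳Φ₂ μ ν z hVΦ hVΦ' hWΦ hδΦ hp) hGtau hId

end Socket

end Summit.QuantumFields.BalabanUV.Beta.D1BFx.KCombineCovLegs

end
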